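import Literature.NumberTheory.Automorphic.FuchsianPoincareSeries
import Literature.NumberTheory.Automorphic.FuchsianEisensteinGrowth
import HarnessLib

/-!
# Poincaré series are continuous, and bounded on `ℍ` for a finite volume group (Motohashi (2.1.5)–(2.1.6))
(Motohashi, *Spectral Theory of the Riemann Zeta-Function*, §2.1 (2.1.5)–(2.1.6), PDF p. 39;
Iwaniec, *Spectral Methods of Automorphic Forms*, GSM 53, §3.1–3.2 (3.9), §2.6 (2.42)–(2.43), PDF pp. 39–43)

Two qualitative properties of the Poincaré series `E_𝔞(z | p) = Σ_{γ ∈ Γ_𝔞 \ Γ} p(σ_𝔞⁻¹γz)`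
(`FuchsianPoincareSeries.poincare`) of a discrete `Γ ≤ SL₂(ℝ)`, `-1 ∈ Γ`, at a cusp `𝔞 = σ_𝔞∞` of
width one, for a continuous `1`-periodic generating function `p`:

1. (§1) **continuity** on `ℍ` when `|p(v)| ≤ C (Im v)^α`, `α > 1` (`continuous_poincarePair`,
   `continuous_poincare`): the Weierstrass test on hyperbolic balls, the summands being dominated by
   `C e^α rowIm(r, w₀)^α` on the unit ball about `w₀` (`Im ωw ≤ Im ωw₀ · e^{ρ(w,w₀)}`) and
   `Σ_r rowIm(r, w₀)^α < ∞` (Lemma 2.10);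
2. (§3) **boundedness on `ℍ`** when moreover `|p(v)| ≤ C (Im v)^α e^{-a Im v}` with `a > 0` — the case
   of Selberg's `p(v) = ψ(Im v) e(mv)`, `m ≥ 1`, `|ψ(y)| ≤ C y^α`, in particular of the Poincaré series
   `P_𝔞m(z, s) = E_𝔞m(z | y^s)`, `Re s > 1` — for a FINITE VOLUME group with a complete system of
   inequivalent cusps (`exists_bound_norm_poincare`, `exists_bound_norm_poincare_selbergGen`). This is
   Motohashi's "`P_m(z, s) ≪ y^{1-Re s}` if `y` is not too small. Thus `P_m(z, s)` belongs to
   `L²(F, dμ)`" ((2.1.6)), in the form needed to unfold inner products against `P_m` (the hypothesis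
   `‖f(σ_𝔞 w)‖ ≤ B` of `FuchsianPoincareSeries.setIntegral_poincare_selbergGen_mul`): by the invariant
   height (2.42) either `z` is `Γ`-equivalent to a point of a fixed compact set (continuity), or
   `γz = σ_j u` with `Im u > 1`, and in the frame of `𝔞_j` the rows `(0, ±1)` (present only for
   `j = 𝔞`) contribute `2 C (Im u)^α e^{-a Im u} ≤ 2 C M₀`, all the other rows have `|c| ≥ 1`, height
   `≤ 1/Im u < 1`, and are summed by Lemma 2.10 (`FuchsianEisensteinGrowth`): `≤ C c(α) · 2`.
   (§2: the elementary bound `y^α e^{-ay} ≤ M₀ = 1 + ⌈α⌉!/a^{⌈α⌉}`.)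

Everything is PROVED (theorems only).

## References
* [Motohashi1997] Y. Motohashi, *Spectral Theory of the Riemann Zeta-Function*, Cambridge Tracts in
  Math. 127, CUP 1997, §2.1 (2.1.5)–(2.1.7), PDF p. 39 (held copy
  `book:motohashi1997-spectral-theory-riemann-zeta-function`).
* [Iwaniec2002] H. Iwaniec, *Spectral Methods of Automorphic Forms*, 2nd ed., GSM 53, AMS 2002, §3.1
  (3.1), §3.2 (3.9), Lemma 2.10, §2.6 (2.42)–(2.43), PDF pp. 38–43.

Mathlib: `continuousOn_tsum`, `Real.exp_one_rpow`, `Real.pow_div_factorial_le_exp`,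
`IsCompact.exists_bound_of_continuousOn`, `Summable.sum_add_tsum_compl`, `Summable.tsum_le_tsum`.
Literature: `poincarePair`, `poincare`, `pairRows`, `rowLift`, `selbergGen`, `summable_rowIm_rpow_pairRows`,
`summable_norm_poincarePair`, `norm_gen_rowLift_le`, `rowIm_le_mul_exp_dist_of_mem_pairRows`,
`isAutomorphic_poincare`, `rows_conj_eq_pairRows`, `im_sl_smul_eq_rowIm`, `rowLift_mem_and_row`,
`norm_selbergGen_eq` (`FuchsianPoincareSeries`); `eisGrowthConst`, `sum_rowIm_rpow_le_eisGrowthConst`,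
`tsum_rowIm_rpow_le_of_le` (`FuchsianEisensteinGrowth`); `invHeight`, `exists_compact_of_invHeight_le`,
`exists_smul_mem_cuspStrip_of_lt`, `invHeight_smul` (`FuchsianInvariantHeight`); `one_le_abs_c_of_ne`,
`im_smul_mul_im_le_one`, `scaling_smul`, `upperRightHom_one_mem_of_periods`, `neg_one_mem_conj_iff`
(`FuchsianCuspZones`, `FuchsianGroupCusps`); `rowIm_le_inv_im` (`FuchsianIncompleteEisenstein`),
`apply_one_eq_of_mem_rows`, `summable_rowIm_rpow`, `conj_le_range'`. Tree search
(`lean search 'continuous_poincare|bound.*poincare|poincare.*bounded'`): nothing of the kind; the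
Eisenstein analogue is `exists_norm_eisCusp_le_invHeight_rpow` (`FuchsianEisensteinGrowth`), whose
architecture this file follows.
-/

noncomputable section

namespace Literature.NumberTheory.Automorphic

open Matrix UpperHalfPlane
open scoped MatrixGroups

namespace Fuchsian

variable {Γ : Subgroup (GL (Fin 2) ℝ)}

/-! ## 1. Continuity of Poincaré series -/

section Continuity

open scoped Pointwise Real
open _root_.MeasureTheory Set Filter

/-- A growth constant in `|p(v)| ≤ C (Im v)^α` is `≥ 0` (test at any point). [folklore] -/
theorem nonneg_of_norm_le_mul_rpow {p : ℍ → ℂ} {C α : ℝ} (hp : ∀ v : ℍ, ‖p v‖ ≤ C * v.im ^ α)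
    (v : ℍ) : 0 ≤ C := by
  by_contra hC
  rw [not_le] at hC
  have h1 := (norm_nonneg _).trans (hp v)
  have h2 : 0 < v.im ^ α := Real.rpow_pos_of_pos v.im_pos α
  nlinarith [mul_neg_of_neg_of_pos hC h2]

/-- The same with an exponential weight: `|p(v)| ≤ C (Im v)^α e^{-a Im v}` forces `C ≥ 0`. [folklore] -/
theorem nonneg_of_norm_le_mul_rpow_mul_exp {p : ℍ → ℂ} {C α a : ℝ}
    (hp : ∀ v : ℍ, ‖p v‖ ≤ C * v.im ^ α * Real.exp (-(a * v.im))) (v : ℍ) : 0 ≤ C := by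
  by_contra hC
  rw [not_le] at hC
  have h1 := (norm_nonneg _).trans (hp v)
  have h2 : 0 < v.im ^ α * Real.exp (-(a * v.im)) := mul_pos (Real.rpow_pos_of_pos v.im_pos α) (Real.exp_pos _)
  nlinarith [mul_neg_of_neg_of_pos hC h2]

/-- Dropping the exponential weight: `|p(v)| ≤ C (Im v)^α e^{-a Im v} ≤ C (Im v)^α` (`a ≥ 0`). [folklore] -/
theorem norm_le_mul_rpow_of_weight {p : ℍ → ℂ} {C α a : ℝ} (ha : 0 ≤ a)
    (hp : ∀ v : ℍ, ‖p v‖ ≤ C * v.im ^ α * Real.exp (-(a * v.im))) (v : ℍ) : ‖p v‖ ≤ C * v.im ^ α := by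
  have hC := nonneg_of_norm_le_mul_rpow_mul_exp hp v
  refine (hp v).trans (mul_le_of_le_one_right (by positivity) ?_)
  rw [Real.exp_le_one_iff]
  nlinarith [v.im_pos]

/-- The unit translation of the frame: `T_1 ∈ σ_𝔞⁻¹Γσ_𝔞` when the periods are `ℤ`. [cite: Iwaniec2002, §2.2 (2.1), PDF p. 30] -/
theorem translSL_one_mem_cuspPairSet {σa : SL(2, ℝ)}
    (hper : (ConjAct.toConjAct (Matrix.SpecialLinearGroup.toGL σa : GL (Fin 2) ℝ)⁻¹ • Γ).strictPeriods =
      AddSubgroup.zmultiples (1 : ℝ)) :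
    translSL 1 ∈ cuspPairSet Γ σa σa := by
  rw [← toGL_mem_conj_iff_mem_cuspPairSet, toGL_translSL, ← Subgroup.mem_strictPeriods_iff, hper]
  exact AddSubgroup.mem_zmultiples 1

/-- **Continuity of `w ↦ E_𝔞(σ_𝔟 w | p)`** for continuous `p` with `|p(v)| ≤ C (Im v)^α`, `α > 1`:
locally uniform convergence (on the hyperbolic unit ball about `w₀` every summand is at most
`C e^α rowIm(r, w₀)^α`, a convergent majorant by Lemma 2.10).
[cite: Iwaniec2002, §3.1–3.2 (3.9) & Lemma 2.10, PDF pp. 38–43] -/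
theorem continuous_poincarePair
    (hΓ : Γ ≤ (Matrix.SpecialLinearGroup.toGL : SL(2, ℝ) →* GL (Fin 2) ℝ).range)
    (hd : IsDiscreteSubgroup Γ) {σa σb : SL(2, ℝ)} (hTa : translSL 1 ∈ cuspPairSet Γ σa σa)
    {p : ℍ → ℂ} (hpc : Continuous p) {C α : ℝ} (hα : 1 < α) (hp : ∀ v : ℍ, ‖p v‖ ≤ C * v.im ^ α) :
    Continuous (poincarePair Γ σa σb p) := by
  have hα0 : 0 ≤ α := by linarith
  unfold poincarePair
  refine continuous_const.mul ?_
  refine continuous_iff_continuousAt.mpr fun w₀ => ?_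
  have hC : 0 ≤ C := nonneg_of_norm_le_mul_rpow hp w₀
  have hS := summable_rowIm_rpow_pairRows hΓ hd hTa hα w₀ (σb := σb)
  have key : ContinuousOn (fun w : ℍ => ∑' r : pairRows Γ σa σb, p (rowLift Γ σa σb r.1 • w))
      (Metric.ball w₀ 1) := by
    refine continuousOn_tsum (fun r => (hpc.comp (continuous_const_smul _)).continuousOn)
      (hS.mul_left (C * Real.exp α)) fun r w hw => ?_
    have hdist : dist w w₀ ≤ 1 := (Metric.mem_ball.mp hw).le
    have h1 := norm_gen_rowLift_le hp r w
    have h2 : rowIm r.1 w ≤ rowIm r.1 w₀ * Real.exp 1 :=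
      (rowIm_le_mul_exp_dist_of_mem_pairRows r.2 w w₀).trans
        (mul_le_mul_of_nonneg_left (Real.exp_le_exp.mpr hdist) (rowIm_nonneg _ _))
    calc ‖p (rowLift Γ σa σb r.1 • w)‖ ≤ C * rowIm r.1 w ^ α := h1
      _ ≤ C * (rowIm r.1 w₀ * Real.exp 1) ^ α := by
          gcongr
          exact rowIm_nonneg _ _
      _ = C * Real.exp α * rowIm r.1 w₀ ^ α := by
          rw [Real.mul_rpow (rowIm_nonneg _ _) (Real.exp_pos _).le, Real.exp_one_rpow]
          ring
  exact key.continuousAt (Metric.isOpen_ball.mem_nhds (Metric.mem_ball_self one_pos))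

/-- **Continuity of the Poincaré series `E_𝔞(· | p)` on `ℍ`** (same hypotheses).
[cite: Iwaniec2002, §3.1–3.2 (3.9), PDF pp. 40–43] -/
theorem continuous_poincare
    (hΓ : Γ ≤ (Matrix.SpecialLinearGroup.toGL : SL(2, ℝ) →* GL (Fin 2) ℝ).range)
    (hd : IsDiscreteSubgroup Γ) {σa : SL(2, ℝ)} (hTa : translSL 1 ∈ cuspPairSet Γ σa σa)
    {p : ℍ → ℂ} (hpc : Continuous p) {C α : ℝ} (hα : 1 < α) (hp : ∀ v : ℍ, ‖p v‖ ≤ C * v.im ^ α) :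
    Continuous (poincare Γ σa p) := by
  unfold poincare
  exact (continuous_poincarePair hΓ hd hTa hpc hα hp).comp (continuous_const_smul _)

/-- Continuity of `P_𝔞m(·) = E_𝔞(· | ψ(y)e(mz))` for continuous `ψ` with `|ψ(y)| ≤ C y^α`, `α > 1`,
`m ≥ 0`. [cite: Iwaniec2002, §3.2 (3.9) & §3.4, PDF pp. 43, 45] -/
theorem continuous_poincare_selbergGen
    (hΓ : Γ ≤ (Matrix.SpecialLinearGroup.toGL : SL(2, ℝ) →* GL (Fin 2) ℝ).range)
    (hd : IsDiscreteSubgroup Γ) {σa : SL(2, ℝ)} (hTa : translSL 1 ∈ cuspPairSet Γ σa σa)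
    {ψ : ℝ → ℂ} (hψc : ContinuousOn ψ (Ioi 0)) {C α : ℝ} (hα : 1 < α)
    (hψ : ∀ u : ℝ, 0 < u → ‖ψ u‖ ≤ C * u ^ α) {m : ℤ} (hm : 0 ≤ m) :
    Continuous (poincare Γ σa (selbergGen ψ m)) :=
  continuous_poincare hΓ hd hTa (continuous_selbergGen hψc m) hα (norm_selbergGen_le hψ hm)

end Continuity

/-! ## 2. The weight `y^α e^{-ay}` is bounded -/

section Weight

/-- `y^α e^{-ay} ≤ 1 + ⌈α⌉!/a^{⌈α⌉}` for `y > 0` (`α ≥ 0`, `a > 0`): `y ≤ 1` trivially, and for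
`y ≥ 1`, `y^α ≤ y^k ≤ k! e^{ay}/a^k` with `k = ⌈α⌉`. [folklore] -/
theorem rpow_mul_exp_neg_le {α a : ℝ} (hα : 0 ≤ α) (ha : 0 < a) {y : ℝ} (hy : 0 < y) :
    y ^ α * Real.exp (-(a * y)) ≤ 1 + (Nat.factorial ⌈α⌉₊ : ℝ) / a ^ ⌈α⌉₊ := by
  set k : ℕ := ⌈α⌉₊ with hk
  have hfa : 0 ≤ (Nat.factorial k : ℝ) / a ^ k := by positivity
  rcases le_or_gt y 1 with h1 | h1
  · have e1 : y ^ α ≤ 1 := Real.rpow_le_one hy.le h1 hα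
    have e2 : Real.exp (-(a * y)) ≤ 1 := by
      rw [Real.exp_le_one_iff]; nlinarith
    calc y ^ α * Real.exp (-(a * y)) ≤ 1 * 1 := mul_le_mul e1 e2 (Real.exp_pos _).le zero_le_one
      _ ≤ _ := by linarith
  · have e1 : y ^ α ≤ y ^ k := by
      have h := Real.rpow_le_rpow_of_exponent_le h1.le (Nat.le_ceil α)
      rwa [← hk, Real.rpow_natCast] at h
    have e3 : (a * y) ^ k / (Nat.factorial k : ℝ) ≤ Real.exp (a * y) :=
      Real.pow_div_factorial_le_exp _ (by positivity) k
    have hkf : (0 : ℝ) < Nat.factorial k := by exact_mod_cast Nat.factorial_pos k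
    have e4 : y ^ k * Real.exp (-(a * y)) ≤ (Nat.factorial k : ℝ) / a ^ k := by
      rw [Real.exp_neg, ← div_eq_mul_inv, div_le_div_iff₀ (Real.exp_pos _) (by positivity)]
      rw [div_le_iff₀ hkf, mul_pow] at e3
      calc y ^ k * a ^ k = a ^ k * y ^ k := mul_comm _ _
        _ ≤ Real.exp (a * y) * (Nat.factorial k : ℝ) := e3
        _ = (Nat.factorial k : ℝ) * Real.exp (a * y) := mul_comm _ _
    calc y ^ α * Real.exp (-(a * y)) ≤ y ^ k * Real.exp (-(a * y)) := by
          gcongr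
      _ ≤ (Nat.factorial k : ℝ) / a ^ k := e4
      _ ≤ _ := by linarith

end Weight

/-! ## 3. Boundedness on `ℍ` for a finite volume group -/

section Bounded

open scoped Pointwise Real
open _root_.MeasureTheory Set Filter

/-- **All rows low** (the frame of another cusp): if `Im((γ g) u) · Im u ≤ 1` for all `γ ∈ Γ` then
`Σ_{rows r of Γ} rowIm(r, g u)^α ≤ c(α)(Y^{-α} + Y^{1-α})`, `Y = Im u` (Lemma 2.10 below height `1/Y`).
[cite: Iwaniec2002, Lemma 2.10 & §3.2 (3.20), PDF pp. 38–39, 46] -/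
theorem tsum_rowIm_rpow_smul_le_of_low
    (hΓ : Γ ≤ (Matrix.SpecialLinearGroup.toGL : SL(2, ℝ) →* GL (Fin 2) ℝ).range)
    (hd : IsDiscreteSubgroup Γ) (hT : Matrix.GeneralLinearGroup.upperRightHom (1 : ℝ) ∈ Γ)
    {α : ℝ} (hα : 1 < α) (g : GL (Fin 2) ℝ) (u : ℍ)
    (hlow : ∀ γ ∈ Γ, ((γ * g) • u).im * u.im ≤ 1) :
    ∑' r : rows Γ, rowIm r.1 (g • u) ^ α ≤ eisGrowthConst α * (u.im ^ (-α) + u.im ^ (1 - α)) := by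
  classical
  have hy : 0 < 1 / u.im := by have := u.im_pos; positivity
  have hle : ∀ r : rows Γ, rowIm r.1 (g • u) ≤ 1 / u.im := by
    intro r
    obtain ⟨γ, hγ, hr⟩ := r.2
    rw [← hr, ← im_smul_eq_rowIm (hΓ hγ), ← mul_smul, le_div_iff₀ u.im_pos]
    exact hlow γ hγ
  have hbound : ∑' r : rows Γ, (rowIm r.1 (g • u)) ^ α ≤
      eisGrowthConst α * ((1 / u.im) ^ α + (1 / u.im) ^ (α - 1)) :=
    Real.tsum_le_of_sum_le (fun r => Real.rpow_nonneg (rowIm_nonneg _ _) _) fun t =>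
      sum_rowIm_rpow_le_eisGrowthConst hΓ hd hT (g • u) hα hy t fun r _ => hle r
  have epow : (1 / u.im) ^ α + (1 / u.im) ^ (α - 1) = u.im ^ (-α) + u.im ^ (1 - α) := by
    rw [one_div, Real.inv_rpow u.im_pos.le, Real.inv_rpow u.im_pos.le, ← Real.rpow_neg u.im_pos.le,
      ← Real.rpow_neg u.im_pos.le, neg_sub]
  rwa [epow] at hbound

/-- **The own frame**: with `-1 ∈ Γ`, the rows `(0, ±1)` have height `Y = Im u` and all the others
height `≤ 1/Y`, so `Σ_r rowIm(r,u)^α e^{-a rowIm(r,u)} ≤ 2 M₀ + c(α)(Y^{-α} + Y^{1-α})` whenever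
`y^α e^{-ay} ≤ M₀`. [cite: Iwaniec2002, Lemma 2.10 & §3.2 (3.20), PDF pp. 38–39, 46] -/
theorem tsum_rowIm_weight_le_self
    (hΓ : Γ ≤ (Matrix.SpecialLinearGroup.toGL : SL(2, ℝ) →* GL (Fin 2) ℝ).range)
    (hneg : (-1 : GL (Fin 2) ℝ) ∈ Γ) (hd : IsDiscreteSubgroup Γ)
    (hT : Matrix.GeneralLinearGroup.upperRightHom (1 : ℝ) ∈ Γ)
    {α a M₀ : ℝ} (hα : 1 < α) (ha : 0 ≤ a) (hM₀ : ∀ y : ℝ, 0 < y → y ^ α * Real.exp (-(a * y)) ≤ M₀) (u : ℍ) :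
    ∑' r : rows Γ, rowIm r.1 u ^ α * Real.exp (-(a * rowIm r.1 u)) ≤
      2 * M₀ + eisGrowthConst α * (u.im ^ (-α) + u.im ^ (1 - α)) := by
  classical
  set f : rows Γ → ℝ := fun r => rowIm r.1 u ^ α * Real.exp (-(a * rowIm r.1 u)) with hf
  have hg : Summable fun r : rows Γ => rowIm r.1 u ^ α := summable_rowIm_rpow hΓ hd hT u hα
  have hfg : ∀ r : rows Γ, f r ≤ rowIm r.1 u ^ α := fun r =>
    mul_le_of_le_one_right (Real.rpow_nonneg (rowIm_nonneg _ _) _)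
      (Real.exp_le_one_iff.mpr (by nlinarith [rowIm_nonneg r.1 u]))
  have hf0 : ∀ r : rows Γ, 0 ≤ f r := fun r =>
    mul_nonneg (Real.rpow_nonneg (rowIm_nonneg _ _) _) (Real.exp_pos _).le
  have hfs : Summable f := Summable.of_nonneg_of_le hf0 hfg hg
  set r₁ : rows Γ := ⟨((1 : GL (Fin 2) ℝ) : Matrix (Fin 2) (Fin 2) ℝ) 1, row_mem_rows Γ.one_mem⟩ with hr₁
  set r₂ : rows Γ := ⟨((-1 : GL (Fin 2) ℝ) : Matrix (Fin 2) (Fin 2) ℝ) 1, row_mem_rows hneg⟩ with hr₂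
  have hr₁0 : r₁.1 0 = 0 := by simp [hr₁]
  have hr₁1 : r₁.1 1 = 1 := by simp [hr₁]
  have hr₂0 : r₂.1 0 = 0 := by simp [hr₂, Units.val_neg]
  have hr₂1 : r₂.1 1 = -1 := by simp [hr₂, Units.val_neg]
  have hne : r₁ ≠ r₂ := by
    intro h
    have := congrArg (fun r : rows Γ => r.1 1) h
    simp only [hr₁1, hr₂1] at this
    norm_num at this
  have him : ∀ r : rows Γ, r.1 0 = 0 → (r.1 1 = 1 ∨ r.1 1 = -1) → rowIm r.1 u = u.im := by
    intro r h0 h1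
    rw [rowIm, normSq_rowDenom, h0]
    rcases h1 with h | h <;> simp [h]
  have hf₁ : f r₁ ≤ M₀ := by simp only [hf, him r₁ hr₁0 (Or.inl hr₁1)]; exact hM₀ _ u.im_pos
  have hf₂ : f r₂ ≤ M₀ := by simp only [hf, him r₂ hr₂0 (Or.inr hr₂1)]; exact hM₀ _ u.im_pos
  set s₀ : Finset (rows Γ) := {r₁, r₂} with hs₀
  have hsplit := hfs.sum_add_tsum_compl (s := s₀)
  have hsum₀ : ∑ x ∈ s₀, f x ≤ 2 * M₀ := by
    rw [hs₀, Finset.sum_pair hne]; linarith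
  -- rows outside `s₀` have `c ≠ 0`, hence height `≤ 1/y`
  have hlow : ∀ r ∈ ((s₀ : Set (rows Γ))ᶜ), rowIm r.1 u ≤ 1 / u.im := by
    intro r hr
    apply rowIm_le_inv_im hΓ hd hT r.2
    intro h0
    apply hr
    rcases apply_one_eq_of_mem_rows hΓ hd hT r.2 h0 with h1 | h1
    · have : r = r₁ := Subtype.ext (funext fun j => by
        fin_cases j
        · simp [h0, hr₁0]
        · simp [h1, hr₁1])
      simp [hs₀, this]
    · have : r = r₂ := Subtype.ext (funext fun j => by
        fin_cases j
        · simp [h0, hr₂0]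
        · simp [h1, hr₂1])
      simp [hs₀, this]
  have hy : 0 < 1 / u.im := by have := u.im_pos; positivity
  have hbound := tsum_rowIm_rpow_le_of_le hΓ hd hT u hα hy ((s₀ : Set (rows Γ))ᶜ) hlow
  have epow : (1 / u.im) ^ α + (1 / u.im) ^ (α - 1) = u.im ^ (-α) + u.im ^ (1 - α) := by
    rw [one_div, Real.inv_rpow u.im_pos.le, Real.inv_rpow u.im_pos.le, ← Real.rpow_neg u.im_pos.le,
      ← Real.rpow_neg u.im_pos.le, neg_sub]
  rw [epow] at hbound
  have htail : ∑' x : ↑((s₀ : Set (rows Γ))ᶜ), f x ≤ ∑' x : ↑((s₀ : Set (rows Γ))ᶜ), rowIm x.1.1 u ^ α :=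
    (hfs.subtype _).tsum_le_tsum (fun x => hfg x.1) (hg.subtype _)
  rw [← hsplit]
  linarith [htail.trans hbound]

variable {σa σb : SL(2, ℝ)}

/-- Summability of the weighted heights over pair rows. [folklore] -/
theorem summable_rowIm_rpow_mul_exp
    (hΓ : Γ ≤ (Matrix.SpecialLinearGroup.toGL : SL(2, ℝ) →* GL (Fin 2) ℝ).range)
    (hd : IsDiscreteSubgroup Γ) (hTa : translSL 1 ∈ cuspPairSet Γ σa σa)
    {α a : ℝ} (hα : 1 < α) (ha : 0 ≤ a) (w : ℍ) :
    Summable fun r : pairRows Γ σa σb => rowIm r.1 w ^ α * Real.exp (-(a * rowIm r.1 w)) :=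
  Summable.of_nonneg_of_le (fun r => mul_nonneg (Real.rpow_nonneg (rowIm_nonneg _ _) _) (Real.exp_pos _).le)
    (fun r => mul_le_of_le_one_right (Real.rpow_nonneg (rowIm_nonneg _ _) _)
      (Real.exp_le_one_iff.mpr (by nlinarith [rowIm_nonneg r.1 w])))
    (summable_rowIm_rpow_pairRows hΓ hd hTa hα w)

/-- **The size of the Poincaré series with an exponentially decaying generating function**:
`|E_𝔞(σ_𝔟 w | p)| ≤ (C/2) Σ_r rowIm(r, w)^α e^{-a rowIm(r, w)}`. [folklore] -/
theorem norm_poincarePair_le_tsum_weight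
    (hΓ : Γ ≤ (Matrix.SpecialLinearGroup.toGL : SL(2, ℝ) →* GL (Fin 2) ℝ).range)
    (hd : IsDiscreteSubgroup Γ) (hTa : translSL 1 ∈ cuspPairSet Γ σa σa)
    {p : ℍ → ℂ} {C α a : ℝ} (hα : 1 < α) (ha : 0 ≤ a)
    (hp : ∀ v : ℍ, ‖p v‖ ≤ C * v.im ^ α * Real.exp (-(a * v.im))) (w : ℍ) :
    ‖poincarePair Γ σa σb p w‖ ≤
      1 / 2 * (C * ∑' r : pairRows Γ σa σb, rowIm r.1 w ^ α * Real.exp (-(a * rowIm r.1 w))) := by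
  have hp' : ∀ v : ℍ, ‖p v‖ ≤ C * v.im ^ α := norm_le_mul_rpow_of_weight ha hp
  have hs := summable_norm_poincarePair hΓ hd hTa hα hp' w (σb := σb)
  have hS := summable_rowIm_rpow_mul_exp hΓ hd hTa hα ha w (σb := σb)
  rw [poincarePair, norm_mul, show ‖(1 / 2 : ℂ)‖ = 1 / 2 by norm_num, ← tsum_mul_left]
  gcongr
  refine (norm_tsum_le_tsum_norm hs).trans ?_
  refine hs.tsum_le_tsum (fun r => ?_) (hS.mul_left C)
  have hmem := rowLift_mem_and_row r.2
  calc ‖p (rowLift Γ σa σb r.1 • w)‖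
      ≤ C * (rowLift Γ σa σb r.1 • w).im ^ α * Real.exp (-(a * (rowLift Γ σa σb r.1 • w).im)) := hp _
    _ = C * (rowIm r.1 w ^ α * Real.exp (-(a * rowIm r.1 w))) := by rw [im_sl_smul_eq_rowIm, hmem.2]; ring

variable {h : ℕ} {𝔞 : Fin h → OnePoint ℝ} {σ : Fin h → SL(2, ℝ)} {F : Set ℍ}

/-- **Poincaré series with exponentially decaying generating function are bounded on `ℍ`**
(Motohashi (2.1.6): "`P_m(z, s) ≪ y^{1-Re s}` if `y` is not too small. Thus `P_m(z,s)` belongs to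
`L²(F, dμ)`"): for a finite volume `Γ ≤ SL₂(ℝ)`, `-1 ∈ Γ`, with a complete system of inequivalent cusps
`𝔞ᵢ = σᵢ∞` of width one, a continuous `1`-periodic `p` with `|p(v)| ≤ C (Im v)^α e^{-a Im v}`
(`α > 1`, `a > 0`), and every `i`: `sup_{z ∈ ℍ} |E_𝔞ᵢ(z | p)| < ∞`.
[cite: Motohashi1997, §2.1 (2.1.5)–(2.1.6), PDF p. 39] -/
theorem exists_bound_norm_poincare
    (hΓ : Γ ≤ (Matrix.SpecialLinearGroup.toGL : SL(2, ℝ) →* GL (Fin 2) ℝ).range)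
    (hneg : (-1 : GL (Fin 2) ℝ) ∈ Γ) (hd : IsDiscreteSubgroup Γ) (hF : IsHypFundamentalDomain Γ F)
    (hvol : volume F < ⊤)
    (hinfty : ∀ i, (Matrix.SpecialLinearGroup.toGL (σ i) : GL (Fin 2) ℝ) • (OnePoint.infty : OnePoint ℝ) = 𝔞 i)
    (hper : ∀ i, (ConjAct.toConjAct (Matrix.SpecialLinearGroup.toGL (σ i) : GL (Fin 2) ℝ)⁻¹ • Γ).strictPeriods =
      AddSubgroup.zmultiples 1)
    (hineq : ∀ i j, ∀ γ ∈ Γ, γ • 𝔞 i = 𝔞 j → i = j)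
    (hcomplete : ∀ c : OnePoint ℝ, IsCusp c Γ → ∃ i, ∃ γ ∈ Γ, γ • 𝔞 i = c)
    {p : ℍ → ℂ} (hpc : Continuous p) (hp1 : ∀ w : ℍ, p ((1 : ℝ) +ᵥ w) = p w)
    {C α a : ℝ} (hα : 1 < α) (ha : 0 < a)
    (hp : ∀ v : ℍ, ‖p v‖ ≤ C * v.im ^ α * Real.exp (-(a * v.im))) (i : Fin h) :
    ∃ B : ℝ, 0 ≤ B ∧ ∀ z : ℍ, ‖poincare Γ (σ i) p z‖ ≤ B := by
  have ee : ∀ (x : SL(2, ℝ)) (w : ℍ), (Matrix.SpecialLinearGroup.toGL x : GL (Fin 2) ℝ) • w = x • w :=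
    fun x w => rfl
  set Sᵢ : GL (Fin 2) ℝ := Matrix.SpecialLinearGroup.toGL (σ i) with hSᵢ
  set Γᵢ : Subgroup (GL (Fin 2) ℝ) := ConjAct.toConjAct Sᵢ⁻¹ • Γ with hΓᵢ
  have hΓᵢle : Γᵢ ≤ (Matrix.SpecialLinearGroup.toGL : SL(2, ℝ) →* GL (Fin 2) ℝ).range :=
    conj_le_range' hΓ (σ i)
  have hdᵢ : IsDiscreteSubgroup Γᵢ := hd.conj _
  have hTᵢ : Matrix.GeneralLinearGroup.upperRightHom (1 : ℝ) ∈ Γᵢ := upperRightHom_one_mem_of_periods (hper i)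
  have hnegᵢ : (-1 : GL (Fin 2) ℝ) ∈ Γᵢ := (neg_one_mem_conj_iff _).mpr hneg
  have hTa : translSL 1 ∈ cuspPairSet Γ (σ i) (σ i) := translSL_one_mem_cuspPairSet (hper i)
  have hα0 : 0 ≤ α := by linarith
  obtain ⟨z₀⟩ : Nonempty ℍ := ⟨UpperHalfPlane.ofComplex Complex.I⟩
  have hC : 0 ≤ C := nonneg_of_norm_le_mul_rpow_mul_exp hp z₀
  have hp' : ∀ v : ℍ, ‖p v‖ ≤ C * v.im ^ α := norm_le_mul_rpow_of_weight ha.le hp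
  have hcont : Continuous (poincare Γ (σ i) p) := continuous_poincare hΓ hd hTa hpc hα hp'
  have haut := isAutomorphic_poincare hΓ hd hneg (hper i) hp1
  obtain ⟨K, hK, hcov⟩ := exists_compact_of_invHeight_le hΓ hneg hd hF hvol hinfty hper hcomplete 1
  obtain ⟨M, hM⟩ := hK.exists_bound_of_continuousOn hcont.continuousOn
  set M₀ : ℝ := 1 + (Nat.factorial ⌈α⌉₊ : ℝ) / a ^ ⌈α⌉₊ with hM₀def
  have hM₀ : ∀ y : ℝ, 0 < y → y ^ α * Real.exp (-(a * y)) ≤ M₀ := fun y hy => rpow_mul_exp_neg_le hα0 ha hy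
  have hM₀0 : 0 ≤ M₀ := by positivity
  set c : ℝ := eisGrowthConst α with hc
  have hcpos : 0 < c := eisGrowthConst_pos hα
  set B : ℝ := max (max M 0) (1 / 2 * (C * (2 * M₀ + c * 2))) with hB
  refine ⟨B, le_trans (le_max_right M 0) (le_max_left _ _), fun z => ?_⟩
  by_cases hle : invHeight Γ σ z ≤ 1
  · -- on the compact core
    obtain ⟨γ, hγ, hγK⟩ := hcov z hle
    rw [← haut γ hγ z]
    exact ((hM _ hγK).trans (le_max_left M 0)).trans (le_max_left _ _)
  · -- high in a cuspidal zone
    rw [not_le] at hle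
    obtain ⟨γ, hγ, j, u, hu, e⟩ := exists_smul_mem_cuspStrip_of_lt hper zero_le_one hle
    have hu1 : 1 < u.im := hu.2.2
    have e1 : poincare Γ (σ i) p z = poincare Γ (σ i) p (σ j • u) := by
      rw [← haut γ hγ z, ← e, ee]
    rw [e1]
    have hp1' : u.im ^ (-α) ≤ 1 := Real.rpow_le_one_of_one_le_of_nonpos hu1.le (by linarith)
    have hp2' : u.im ^ (1 - α) ≤ 1 := Real.rpow_le_one_of_one_le_of_nonpos hu1.le (by linarith)
    have htail : c * (u.im ^ (-α) + u.im ^ (1 - α)) ≤ c * 2 := by nlinarith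
    refine le_trans ?_ (le_max_right _ _)
    by_cases hji : j = i
    · subst hji
      have e2 : poincare Γ (σ j) p (σ j • u) = poincarePair Γ (σ j) (σ j) p u := by
        unfold poincare; rw [inv_smul_smul]
      rw [e2]
      refine (norm_poincarePair_le_tsum_weight hΓ hd hTa hα ha.le hp u).trans ?_
      have hS : ∑' r : pairRows Γ (σ j) (σ j), rowIm r.1 u ^ α * Real.exp (-(a * rowIm r.1 u)) ≤
          2 * M₀ + c * (u.im ^ (-α) + u.im ^ (1 - α)) := by
        have h := tsum_rowIm_weight_le_self hΓᵢle hnegᵢ hdᵢ hTᵢ hα ha.le hM₀ u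
        rw [rows_conj_eq_pairRows hΓ (σ j)] at h
        exact h
      have hS' : ∑' r : pairRows Γ (σ j) (σ j), rowIm r.1 u ^ α * Real.exp (-(a * rowIm r.1 u)) ≤
          2 * M₀ + c * 2 := hS.trans (by linarith)
      gcongr
    · have e2 : poincare Γ (σ i) p (σ j • u) = poincarePair Γ (σ i) (σ i) p ((σ i)⁻¹ • σ j • u) := rfl
      set g : GL (Fin 2) ℝ := Matrix.SpecialLinearGroup.toGL ((σ i)⁻¹ * σ j) with hg
      have ept : (σ i)⁻¹ • σ j • u = g • u := by
        rw [← ee (σ j) u, ← ee (σ i)⁻¹, ← mul_smul, ← map_mul]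
      rw [e2, ept]
      refine (norm_poincarePair_le_tsum_weight hΓ hd hTa hα ha.le hp (g • u)).trans ?_
      -- every `γ' g`, `γ' ∈ Γᵢ`, is `σᵢ⁻¹ (δ σⱼ)` with `δ𝔞ⱼ ≠ 𝔞ᵢ`: lower-left entry `≥ 1`
      have hlow : ∀ γ' ∈ Γᵢ, ((γ' * g) • u).im * u.im ≤ 1 := by
        intro γ' hγ'
        have hδ : Sᵢ * γ' * Sᵢ⁻¹ ∈ Γ := (mem_conj_inv_iff Sᵢ γ').mp hγ'
        obtain ⟨δ, hδe⟩ := hΓ hδ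
        have hδmem : (Matrix.SpecialLinearGroup.toGL δ : GL (Fin 2) ℝ) ∈ Γ := by rw [hδe]; exact hδ
        obtain ⟨hτ, hperτ⟩ := scaling_smul (hinfty j) (hper j) hδmem
        have hne : 𝔞 i ≠ (Matrix.SpecialLinearGroup.toGL δ : GL (Fin 2) ℝ) • 𝔞 j := by
          intro he
          exact hji (hineq j i _ hδmem he.symm)
        have hc1 := one_le_abs_c_of_ne hΓ hd (hinfty i) (hper i) hτ hperτ hne
        have hprod : γ' * g = Matrix.SpecialLinearGroup.toGL ((σ i)⁻¹ * (δ * σ j)) := by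
          have e3 : γ' = Sᵢ⁻¹ * (Sᵢ * γ' * Sᵢ⁻¹) * Sᵢ := by group
          rw [e3, ← hδe, hg, hSᵢ, map_mul, map_mul, map_mul, map_inv]
          group
        rw [hprod]
        refine im_smul_mul_im_le_one ⟨_, rfl⟩ ?_ u
        exact hc1
      have hS : ∑' r : pairRows Γ (σ i) (σ i), rowIm r.1 (g • u) ^ α * Real.exp (-(a * rowIm r.1 (g • u))) ≤
          c * (u.im ^ (-α) + u.im ^ (1 - α)) := by
        have h1 := tsum_rowIm_rpow_smul_le_of_low hΓᵢle hdᵢ hTᵢ hα g u hlow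
        rw [rows_conj_eq_pairRows hΓ (σ i)] at h1
        refine le_trans ?_ h1
        exact (summable_rowIm_rpow_mul_exp hΓ hd hTa hα ha.le (g • u)).tsum_le_tsum
          (fun r => mul_le_of_le_one_right (Real.rpow_nonneg (rowIm_nonneg _ _) _)
            (Real.exp_le_one_iff.mpr (by nlinarith [rowIm_nonneg r.1 (g • u)])))
          (summable_rowIm_rpow_pairRows hΓ hd hTa hα (g • u))
      have hS' : ∑' r : pairRows Γ (σ i) (σ i), rowIm r.1 (g • u) ^ α * Real.exp (-(a * rowIm r.1 (g • u))) ≤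
          2 * M₀ + c * 2 := by nlinarith
      gcongr

/-- **Boundedness of `P_𝔞m(z) = E_𝔞(z | ψ(y) e(mz))` on `ℍ`** for `m ≥ 1`, continuous `ψ` with
`|ψ(y)| ≤ C y^α` (`α > 1`) — e.g. `ψ(y) = y^s`, `Re s > 1`, Motohashi's `P_m(z, s)` — for a finite
volume group with a complete system of inequivalent cusps of width one.
[cite: Motohashi1997, §2.1 (2.1.5)–(2.1.6), PDF p. 39] -/
theorem exists_bound_norm_poincare_selbergGen
    (hΓ : Γ ≤ (Matrix.SpecialLinearGroup.toGL : SL(2, ℝ) →* GL (Fin 2) ℝ).range)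
    (hneg : (-1 : GL (Fin 2) ℝ) ∈ Γ) (hd : IsDiscreteSubgroup Γ) (hF : IsHypFundamentalDomain Γ F)
    (hvol : volume F < ⊤)
    (hinfty : ∀ i, (Matrix.SpecialLinearGroup.toGL (σ i) : GL (Fin 2) ℝ) • (OnePoint.infty : OnePoint ℝ) = 𝔞 i)
    (hper : ∀ i, (ConjAct.toConjAct (Matrix.SpecialLinearGroup.toGL (σ i) : GL (Fin 2) ℝ)⁻¹ • Γ).strictPeriods =
      AddSubgroup.zmultiples 1)
    (hineq : ∀ i j, ∀ γ ∈ Γ, γ • 𝔞 i = 𝔞 j → i = j)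
    (hcomplete : ∀ c : OnePoint ℝ, IsCusp c Γ → ∃ i, ∃ γ ∈ Γ, γ • 𝔞 i = c)
    {ψ : ℝ → ℂ} (hψc : ContinuousOn ψ (Ioi 0)) {C α : ℝ} (hα : 1 < α)
    (hψ : ∀ u : ℝ, 0 < u → ‖ψ u‖ ≤ C * u ^ α) {m : ℤ} (hm : 1 ≤ m) (i : Fin h) :
    ∃ B : ℝ, 0 ≤ B ∧ ∀ z : ℍ, ‖poincare Γ (σ i) (selbergGen ψ m) z‖ ≤ B := by
  have hm0 : (0 : ℝ) < m := by
    have h1 : (1 : ℝ) ≤ m := by exact_mod_cast hm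
    linarith
  have ha : 0 < 2 * π * (m : ℝ) := by positivity
  refine exists_bound_norm_poincare hΓ hneg hd hF hvol hinfty hper hineq hcomplete
    (continuous_selbergGen hψc m) (selbergGen_vadd_one ψ m) hα ha (C := C) (fun v => ?_) i
  rw [norm_selbergGen_eq]
  have h1 := hψ v.im v.im_pos
  have h2 : Real.exp (-(2 * π * m * v.im)) = Real.exp (-(2 * π * (m : ℝ) * v.im)) := rfl
  calc ‖ψ v.im‖ * Real.exp (-(2 * π * m * v.im)) ≤ C * v.im ^ α * Real.exp (-(2 * π * m * v.im)) := by
        gcongr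
    _ = C * v.im ^ α * Real.exp (-(2 * π * (m : ℝ) * v.im)) := rfl

end Bounded

end Fuchsian

end Literature.NumberTheory.Automorphic
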